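import Summits.HubbardSuperconductivity.HubbardSuperconductivity.Theses.DeformationLadder

/-!
# Sketch — crux-ideate stmt-HubbardSuperconductivity-1892 (`DeformationLadder.LowEnergyRigidity`),
ideator 3, round 1

First lemmas of the two idea cards, typed over existing declarations (signatures only; proofs are
NOT claimed here — every `theorem` below is a `sorry` placeholder for a statement the card marks
"provable now", every `def … : Prop` is an item the card proposes).

* Card `poincare-telescope` (§A): block pair fields `blockPair`, the block Dirichlet operator
  `blockDirichlet`, the abstract OPERATOR-COEFFICIENT Gram lemma `gramPSD_of_posSemidef` (first
  lemma), its torus/grid Poincaré instances `TorusOperatorPoincare` / `GridOperatorPoincare`, the two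
  open inputs `JosephsonInequalityAt` (scale-wise, slack ∝ k³/L) and `CoherenceFloorAt`
  (thermodynamic), and the reduction `TelescopeReduction : … → LowEnergyRigidity`.
* Card `heavy-condensate-fibration` (§B): the condensate operator `condOp`, the exact IMS identity
  `ims_identity` (first lemma, pure algebra), the Hubbard double-commutator bound
  `CondensateIsHeavy` (‖[Π,[Π,H]]‖ = O(L⁻²)), the divided-difference transfer `SmoothCutoffBound`,
  the condensate-poor spectral subspace `condPoor`, the transfer `CompressionGapAt` and the
  equivalence `compressionGap_iff_rigidity`.
-/

noncomputable section

set_option linter.dupNamespace false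

namespace Summit.HubbardSuperconductivity.HubbardSuperconductivity.Cruxes.LowEnergyRigidity.Sketch

open Literature.MathematicalPhysics.QuantumLattice Literature.Probability.LatticeModels
open Filter Set Finset
open scoped Matrix ComplexOrder BigOperators
open _root_.Topology
open Summit.HubbardSuperconductivity.HubbardSuperconductivity.Theses.DeformationLadder (LowEnergyRigidity)

/-! ## Common notation -/

/-- The Statement's particle number at side `L` and doping `δ`. -/
def statN (δ : ℝ) (L : ℕ) : ℕ := 2 * ⌊(1 - δ) * (L : ℝ) ^ 2 / 2⌋₊

/-- Abbreviation for the many-body matrix algebra on the side-`L` torus. -/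
abbrev Op (L : ℕ) : Type :=
  Matrix (Finset (Orb (FermionTorus 2 L))) (Finset (Orb (FermionTorus 2 L))) ℂ

/-- The Hubbard torus of the crux, `H_L = hubbardTorus 2 L 1 U`. -/
abbrev Hm (L : ℕ) (U : ℝ) : Op L := hubbardTorus 2 L 1 U

/-- The sector ground energy `E₀(L)` of the crux. -/
def E0 (L : ℕ) (U δ : ℝ) : ℝ := (Hm L U).minEnergyOn (szSector (statN δ L) 0)

/-- The condensate (d-wave pair LRO density) operator `Π_L := L⁻⁴ Δᴴ Δ`, `Δ = pairField dWaveFormFactor L`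
(the crux's `expect (Δᴴ Δ) φ / L⁴` is `expect (condOp L) φ`). -/
def condOp (L : ℕ) [NeZero L] : Op L :=
  ((1 : ℂ) / ((L : ℂ) ^ 4)) • ((pairField dWaveFormFactor L)ᴴ * pairField dWaveFormFactor L)

/-- Commutator of two matrices. -/
def comm {L : ℕ} (A B : Op L) : Op L := A * B - B * A

/-! ## §A  Card `poincare-telescope` -/

/-- Nearly uniform block index: `ZMod L → ZMod k`, `x ↦ ⌊x·k/L⌋` (blocks of side `⌊L/k⌋` or `⌈L/k⌉`). -/
def blockIndex (L k : ℕ) (x : ZMod L) : ZMod k := ((x.val * k / L : ℕ) : ZMod k)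

/-- The block of a torus site (product of the one-dimensional block indices). -/
def blockOf (L k : ℕ) (x : TorusSite 2 L) : TorusSite 2 k := fun i => blockIndex L k (x i)

/-- BLOCK PAIR FIELD `Δ_b := Σ_{x : blockOf x = b} localPair d L x` (anchor-site blocks), so that
`Σ_b Δ_b = pairField` exactly (`sum_blockPair`). -/
def blockPair (L k : ℕ) [NeZero L] (b : TorusSite 2 k) : Op L :=
  ∑ x ∈ (Finset.univ.filter fun x : TorusSite 2 L => blockOf L k x = b), localPair dWaveFormFactor L x

/-- Blocks partition the anchor sites: `Σ_b Δ_b = Δ`. (Provable now: `Finset.sum_fiberwise`.) -/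
theorem sum_blockPair (L k : ℕ) [NeZero L] [NeZero k] :
    ∑ b : TorusSite 2 k, blockPair L k b = pairField dWaveFormFactor L := by
  sorry

/-- BLOCK DIRICHLET OPERATOR on the block torus `(ℤ/kℤ)²`:
`𝒟_k := Σ_b Σ_{i=1,2} (Δ_b - Δ_{b+eᵢ})ᴴ (Δ_b - Δ_{b+eᵢ})` (a sum of positive operators). -/
def blockDirichlet (L k : ℕ) [NeZero L] [NeZero k] : Op L :=
  ∑ b : TorusSite 2 k, ∑ i : Fin 2,
    (blockPair L k b - blockPair L k (b + Pi.single i 1))ᴴ * (blockPair L k b - blockPair L k (b + Pi.single i 1))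

/-- BLOCK COHERENCE OPERATOR `𝒞_k := Σ_b Δ_bᴴ Δ_b` (so `k²/L⁴ · 𝒞_k` is the average block LRO density
at scale `ℓ = L/k`). -/
def blockCoherence (L k : ℕ) [NeZero L] [NeZero k] : Op L :=
  ∑ b : TorusSite 2 k, (blockPair L k b)ᴴ * blockPair L k b

/-- FIRST LEMMA (card `poincare-telescope`; provable now, ~40 lines): a real positive-semidefinite
matrix acts positively on TUPLES OF OPERATORS — for `M ⪰ 0` and any family `u : β → Op L`,
`Σ_{b,b'} M_{bb'} · u_bᴴ u_{b'} ⪰ 0` (write `M = Σ_r v^r (v^r)ᵀ`; each term is `(Σ_b v^r_b u_b)ᴴ (Σ_b v^r_b u_b)`).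
No commutativity of the `u_b` is used. -/
theorem gramPSD_of_posSemidef {L : ℕ} {β : Type} [Fintype β] [DecidableEq β]
    (M : Matrix β β ℝ) (hM : M.PosSemidef) (u : β → Op L) :
    (∑ b : β, ∑ b' : β, ((M b b' : ℝ) : ℂ) • ((u b)ᴴ * u b')).PosSemidef := by
  sorry

/-- OPERATOR POINCARÉ ON THE BLOCK TORUS (provable now from `gramPSD_of_posSemidef` with
`M := Laplacian((ℤ/kℤ)²) - λ₁ (1 - J/k²)`, `λ₁ = 2 - 2cos(2π/k)`, and `sum_blockPair`):
`𝒟_k ⪰ λ₁ · (𝒞_k - k⁻² Δᴴ Δ)`, i.e. GLOBAL LRO ⪰ BLOCK COHERENCE − DIRICHLET/λ₁ as operators: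
`Δᴴ Δ ⪰ k² 𝒞_k - (k²/λ₁) 𝒟_k`. -/
def TorusOperatorPoincare : Prop :=
  ∀ (L k : ℕ) [NeZero L] [NeZero k], 3 ≤ k →
    (blockDirichlet L k -
      ((2 - 2 * Real.cos (2 * Real.pi / k) : ℝ) : ℂ) •
        (blockCoherence L k -
          ((1 : ℂ) / ((k : ℂ) ^ 2)) • ((pairField dWaveFormFactor L)ᴴ * pairField dWaveFormFactor L))).PosSemidef

/-- OPERATOR POINCARÉ INSIDE A PARENT BLOCK (Neumann / grid version, provable now the same way with the
path-graph Laplacian, `λ₁(P_m □ P_m) = 2 - 2cos(π/m) ≥ 8/m²`): refining `k ↦ m·k` blocks (each parent `B`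
is the union of `m²` children `b`, `Δ_B = Σ_{b ⊂ B} Δ_b`, `ū = Δ_B/m²`),
`Δ_Bᴴ Δ_B ⪰ m² Σ_{b ⊂ B} Δ_bᴴ Δ_b - (m²/λ₁) 𝒟^{grid}_B` for every parent block `B`, hence summed over
parents `𝒞_k ⪰ m² 𝒞_{mk} - (m²/λ₁) 𝒟_{mk}` (intra-parent edges are a sub-sum of `𝒟_{mk}`); in DENSITY units
(`ρ_k := (k²/L⁴) 𝒞_k`) this reads `ρ_k ⪰ ρ_{mk} - (k² m²/(λ₁ L⁴)) 𝒟_{mk}`. -/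
def GridOperatorPoincare : Prop :=
  ∀ (L k m : ℕ) [NeZero L] [NeZero k] [NeZero (m * k)], 2 ≤ m →
    ((((m : ℂ) ^ 2) / ((2 - 2 * Real.cos (Real.pi / m) : ℝ) : ℂ)) • blockDirichlet L (m * k) -
      (((m : ℂ) ^ 2) • blockCoherence L (m * k) - blockCoherence L k)).PosSemidef

/-- OPEN INPUT 1 — JOSEPHSON INEQUALITY AT SCALE `ℓ = L/k` (card `poincare-telescope`, the `O(1)` content,
stated pointwise in `(U,δ)` with the rate `J` and slack constant `C`): on the `(N_L,0)` sector,
`H_L - E₀ ≥ J·(k/L)⁴·𝒟_k - C·J·k³/L` as quadratic forms, eventually in even `L`, for every block count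
`k` with `4 ≤ k ≤ L/ℓ₀`. The slack `C J k³/L = C J n_ℓ/ℓ` (`n_ℓ = k²` blocks of side `ℓ`) is EXTENSIVE at
the lattice scale `ℓ = ℓ₀` and `o(1)` at the top scale `k = 4`; `J = ρ_p/2` (pair helicity modulus)
saturates it on twisted states, and the ground state's zero-point Dirichlet content `≍ n_ℓ v/(ρ ℓ)` fits
inside the slack. -/
def JosephsonInequalityAt (U δ J C : ℝ) (ℓ₀ : ℕ) : Prop :=
  ∃ L₀ : ℕ, ∀ (L : ℕ) [NeZero L], L₀ ≤ L → Even L → ∀ (k : ℕ) [NeZero k], 4 ≤ k → k * ℓ₀ ≤ L →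
    ∀ φ : Fock (Orb (FermionTorus 2 L)), φ ∈ szSector (statN δ L) 0 →
      J * ((k : ℝ) / L) ^ 4 * (expect (blockDirichlet L k) φ).re - C * J * (k : ℝ) ^ 3 / L * (star φ ⬝ᵥ φ).re
        ≤ (expect (Hm L U) φ).re - E0 L U δ * (star φ ⬝ᵥ φ).re

/-- OPEN INPUT 2 — COHERENCE FLOOR AT THE LATTICE SCALE (card `poincare-telescope`, THERMODYNAMIC content):
states whose average block coherence at the fixed scale `ℓ₀` (block count `k = ⌊L/ℓ₀⌋`) falls below
`r₀ - ε` pay an EXTENSIVE energy `c·L²`. By convex duality it is equivalent to strict positivity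
`r₀ = -ε'(0⁻) > 0` of the left slope at `0` of the concave energy density
`ε(J') = lim L⁻² minEnergyOn (H_L - J'·(k/L)⁴ L² 𝒞_k)` (a LOCAL, finite-range pair-coherence field). -/
def CoherenceFloorAt (U δ r₀ : ℝ) (ℓ₀ : ℕ) : Prop :=
  ∀ ε : ℝ, 0 < ε → ∃ c : ℝ, 0 < c ∧ ∃ L₀ : ℕ, ∀ (L : ℕ) [NeZero L], L₀ ≤ L → Even L →
    ∀ (k : ℕ) [NeZero k], k = L / ℓ₀ →
    ∀ φ : Fock (Orb (FermionTorus 2 L)), φ ∈ szSector (statN δ L) 0 → star φ ⬝ᵥ φ = 1 →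
      (expect (Hm L U) φ).re ≤ E0 L U δ + c * (L : ℝ) ^ 2 →
        r₀ - ε ≤ ((k : ℝ) ^ 2 / (L : ℝ) ^ 4) * (expect (blockCoherence L k) φ).re

/-- THE REDUCTION (card `poincare-telescope`; glue provable now from `TorusOperatorPoincare`,
`GridOperatorPoincare`, dyadic telescoping `k = 4, 8, …, ⌊L/ℓ₀⌋` and Markov): a thermodynamic coherence
floor plus the scale-wise Josephson inequalities at ONE point `(U,δ)` give the crux, with
`a = r₀ - ε - C/ℓ₀ - κ/(32 J) - o(1)` (per dyadic step the loss is `κ/(2J(2k)²) + C/(2ℓ')`, `λ₁^N(2) = 2`). -/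
def TelescopeReduction : Prop :=
  (∃ U : ℝ, 0 < U ∧ ∃ δ ∈ Set.Ioo (0:ℝ) (1 / 2), ∃ J : ℝ, 0 < J ∧ ∃ C : ℝ, ∃ r₀ : ℝ, 0 < r₀ ∧ ∃ ℓ₀ : ℕ, 0 < ℓ₀ ∧
      JosephsonInequalityAt U δ J C ℓ₀ ∧ CoherenceFloorAt U δ r₀ ℓ₀) →
    LowEnergyRigidity

/-! ## §B  Card `heavy-condensate-fibration` -/

/-- FIRST LEMMA (card `heavy-condensate-fibration`; provable now, five lines of ring algebra): the EXACT
IMS identity — for any `K₁, K₂` with `K₁² + K₂² = 1` (no commutation hypotheses),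
`H = K₁ H K₁ + K₂ H K₂ + ½([K₁,[K₁,H]] + [K₂,[K₂,H]])`. -/
theorem ims_identity {L : ℕ} (H K₁ K₂ : Op L) (hK : K₁ * K₁ + K₂ * K₂ = 1) :
    H = K₁ * H * K₁ + K₂ * H * K₂ +
      ((1 : ℂ) / 2) • (comm K₁ (comm K₁ H) + comm K₂ (comm K₂ H)) := by
  sorry

/-- THE CONDENSATE IS A HEAVY VARIABLE (card `heavy-condensate-fibration`; provable now, a few hundred
lines of CAR bookkeeping): `‖[Π_L,[Π_L,H_L]]‖ ≤ C(1+|U|)/L²` in quadratic-form form (the double commutator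
is Hermitian). Inputs: `‖[Δ,Δᴴ]‖ = O(L²)` (one-body), `[T,Δ_d] = 2Δ_d^{(2)}` (range-2 d-wave pairs;
on-site and diagonal pieces cancel by B₁g), `[D,Δ_d]` local, hence `‖[A,[A,H]]‖, ‖[Aᴴ,[A,H]]‖ = O(L⁻²)`
for `A = L⁻² Δ`. -/
def CondensateIsHeavy : Prop :=
  ∃ C : ℝ, ∀ (U : ℝ) (L : ℕ) [NeZero L], ∀ φ : Fock (Orb (FermionTorus 2 L)),
    |(expect (comm (condOp L) (comm (condOp L) (Hm L U))) φ).re| ≤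
      C * (1 + |U|) / (L : ℝ) ^ 2 * (star φ ⬝ᵥ φ).re

/-- DIVIDED-DIFFERENCE TRANSFER (provable now; finite-dimensional operator-Lipschitz estimate via the
Fourier representation of the divided difference as a superposition of unimodular Schur multipliers):
for a Hermitian `Q` and the smooth cutoff pair `K₁ = cos F(Q)`, `K₂ = sin F(Q)` (`F ∈ C_c^∞`, functional
calculus `cfc`), `‖[Kᵢ,[Kᵢ,H]]‖ ≤ C_F ‖[Q,[Q,H]]‖` with `C_F` depending on `F` only. Stated for `Q = Π_L`. -/
def SmoothCutoffBound : Prop :=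
  ∀ (F : ℝ → ℝ), ContDiff ℝ ⊤ F → HasCompactSupport (deriv F) → ∃ C_F : ℝ, ∀ (U : ℝ) (L : ℕ) [NeZero L],
    ∀ φ : Fock (Orb (FermionTorus 2 L)),
      |(expect (comm (cfc (fun x : ℝ => Real.cos (F x)) (condOp L))
          (comm (cfc (fun x : ℝ => Real.cos (F x)) (condOp L)) (Hm L U))) φ).re| ≤
        C_F * (⨆ ψ : {ψ : Fock (Orb (FermionTorus 2 L)) // star ψ ⬝ᵥ ψ = 1},
          |(expect (comm (condOp L) (comm (condOp L) (Hm L U))) ψ.1).re|) * (star φ ⬝ᵥ φ).re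

/-- The CONDENSATE-POOR SPECTRAL SUBSPACE `K_a(L) := ⊕_{μ ≤ a} ker(Π_L - μ)` — a purely KINEMATIC
(U-independent) subspace of Fock space, intersected below with the sector. -/
def condPoor (L : ℕ) [NeZero L] (a : ℝ) : Submodule ℂ (Fock (Orb (FermionTorus 2 L))) :=
  ⨆ (μ : ℝ) (_ : μ ≤ a), Module.End.eigenspace (Matrix.toLin' (condOp L)) (μ : ℂ)

/-- TRANSFER `C⁺` (card `heavy-condensate-fibration`): the COMPRESSION GAP — the ground energy of `H_L`
compressed to the condensate-poor part of the sector (`minEnergyOn` is by definition the infimum of the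
Rayleigh quotient over the subspace, i.e. the bottom of the compression) exceeds `E₀(L)` by `κ`,
eventually in even `L`. -/
def CompressionGapAt (U δ a κ : ℝ) : Prop :=
  ∃ L₀ : ℕ, ∀ (L : ℕ) [NeZero L], L₀ ≤ L → Even L →
    E0 L U δ + κ ≤ (Hm L U).minEnergyOn (szSector (statN δ L) 0 ⊓ condPoor L a)

/-- EQUIVALENCE (provable now from `ims_identity` + `CondensateIsHeavy` + `SmoothCutoffBound` + Markov in `Π`;
constants degrade by factors of 2): the crux IS a compression gap of the kinematic condensate-poor
subspace. `→`: `CompressionGapAt U δ (2a) κ` gives rigidity with `(a/2, κ/2 - o(1))`; `←`: rigidity with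
`(a, κ)` gives `CompressionGapAt U δ (a/2) κ` (a unit vector of `condPoor (a/2)` has `⟨Π⟩ ≤ a/2 < a`). -/
def compressionGap_iff_rigidity : Prop :=
  (∃ U : ℝ, 0 < U ∧ ∃ δ ∈ Set.Ioo (0:ℝ) (1 / 2), ∃ a : ℝ, 0 < a ∧ ∃ κ : ℝ, 0 < κ ∧ CompressionGapAt U δ a κ)
    ↔ LowEnergyRigidity

end Summit.HubbardSuperconductivity.HubbardSuperconductivity.Cruxes.LowEnergyRigidity.Sketch
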